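import Literature.AnabelianGeometry.AbsoluteAnabelian.AbsTopIII.KummerCuspLaws
import Literature.AnabelianGeometry.AbsoluteAnabelian.AbsTopIII.Thm19bOfPresentationsHolds
import Literature.AnabelianGeometry.AbsoluteAnabelian.FreeProcyclicStructure
import Literature.Algebra.Module.PadicProductEndomorphisms
import HarnessLib

/-!
# [AbsTopIII] Thm. 1.9 (b): CONSTRUCTION of the cusp-synchronization presentations ("the third curves
# `U ⊆ Z ∖ {z} ⊆ Z`") in every law-abiding model, and `Thm_1_9_b` from the named facts Prop. 1.4 (i)(ii)

Mochizuki, *Topics in Absolute Anabelian Geometry III*, §1, Thm. 1.9 (b) p. 37 ("One constructs the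
natural isomorphisms `I_z ⥲ μ_Ẑ(Π_U) := M_Z` — where [...] `Z` is the canonical compactification of `Y`,
the points of `Z ∖ U` are all rational over the base field `k_Z` of `Z`, `z ∈ (Z ∖ U)(k_Z)` — via the
technique of Proposition 1.4, (ii)") and Prop. 1.4 (i)(ii) p. 31 (lit key `paper:url-5493eb38cbb7`).

Proof-only companion (abc-iut-L4-t1, interface owner) of `KummerCuspLaws.lean`.  abc-iut-w5-d213's
`CurveModel.CuspSyncPresentation h` (the third curves with their Prop. 1.4 (i)/(ii) data) was INTERFACE
DATA; abc-iut-w5-d099's `CurveModel.thm_1_9_b_of_cuspSyncPresentations` proved `Thm_1_9_b` modulo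
their EXISTENCE (`hP`).  Here the presentations are CONSTRUCTED for every `M : CoherentKummerModel` from
the model-closure law `exists_open_between` (the curve `Z ∖ {z}`), the coherent cusp laws
(`cuspRes`, `decomp_cuspRes`, `exists_cuspRes_eq`), `decomp_inf_geom`, and abc-iut-L4-t1's named facts
`Prop_1_4_i` (cuspidal inertia groups free procyclic), `Prop_1_4_i'` (the surjections `Π_U ↠ Π_{U_x}`),
`Prop_1_4_ii` (cuspidally central extension), `Prop_1_4_ii_transgression` (the differential is
bijective) BY NAME — whence

* `CoherentKummerModel.nonempty_cuspSyncPresentation` and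
* `CoherentKummerModel.thm_1_9_b : Prop_1_4_i → Prop_1_4_i' → Prop_1_4_ii → Prop_1_4_ii_transgression →
  M.Thm_1_9_b` (sub-DAG row Thm19.b.r5 / F-0346 at every law-abiding model, modulo named facts only).

On the way: a surjective homomorphism between free procyclic profinite groups is injective
(`End(Ẑ) = Ẑ`, `Literature.Algebra.Module.PadicProductEnd.addMonoidHom_pi_apply_eq_mul`).  All
declarations are theorems; no new facts.  HONEST FRAMING: nothing here bears on [IUTchIII] Cor. 3.12.
-/

noncomputable section

open CategoryTheory
open scoped Classical Pointwise

namespace Literature.AnabelianGeometry.AbsoluteAnabelian.AbsTopIII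

universe u

/-! ### Free procyclic profinite groups are Hopfian (via `End(Ẑ) = Ẑ`) -/

section Hopf

open Literature.Algebra.Module.PadicProductEnd

variable {I J : Type u} [Group I] [TopologicalSpace I] [IsTopologicalGroup I] [CompactSpace I]
  [T2Space I] [TotallyDisconnectedSpace I] [Group J] [TopologicalSpace J] [IsTopologicalGroup J]
  [CompactSpace J] [T2Space J] [TotallyDisconnectedSpace J]

/-- **A surjective homomorphism between free procyclic profinite groups is injective**: both are
`≅ Ẑ = ∏_p ℤ_p` (additively), every additive endomorphism of `∏_p ℤ_p` is multiplication by an element,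
and a surjective multiplication is multiplication by a unit ("`I_x` [...] naturally isomorphic to
`Ẑ(1)`", Prop. 1.4 (i) p. 31: a surjection `Ẑ ↠ Ẑ` is an isomorphism).
[cite: MochizukiAbsTopIII2015, Prop 1.4 (i) p.31] -/
theorem injective_of_surjective_of_isFreeProcyclic (hI : FundamentalExtension.IsFreeProcyclic I)
    (hJ : FundamentalExtension.IsFreeProcyclic J) (f : I →* J) (hf : Function.Surjective f) :
    Function.Injective f := by
  obtain ⟨eI, -⟩ := hI.exists_continuousAddEquiv_padicProd
  obtain ⟨eJ, -⟩ := hJ.exists_continuousAddEquiv_padicProd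
  let φ : PiZp →+ PiZp :=
    eJ.toAddEquiv.toAddMonoidHom.comp
      ((MonoidHom.toAdditive f).comp eI.symm.toAddEquiv.toAddMonoidHom)
  have hφ : ∀ x, φ x = x * φ 1 := addMonoidHom_pi_apply_eq_mul φ
  have hφs : Function.Surjective φ := by
    intro y
    obtain ⟨i, hi⟩ := hf (Additive.toMul (eJ.symm y))
    refine ⟨eI (Additive.ofMul i), ?_⟩
    change eJ (Additive.ofMul (f (Additive.toMul (eI.symm (eI (Additive.ofMul i)))))) = y
    rw [eI.symm_apply_apply]
    change eJ (Additive.ofMul (f i)) = y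
    rw [hi]
    exact eJ.apply_symm_apply y
  obtain ⟨b, hb⟩ := hφs 1
  have hunit : IsUnit (φ 1) := IsUnit.of_mul_eq_one_right b (by rw [← hφ b, hb])
  have hφi : Function.Injective φ := by
    intro x y hxy
    rw [hφ x, hφ y] at hxy
    exact hunit.mul_left_injective hxy
  intro x y hxy
  have h1 : φ (eI (Additive.ofMul x)) = φ (eI (Additive.ofMul y)) := by
    change eJ (Additive.ofMul (f (Additive.toMul (eI.symm (eI (Additive.ofMul x)))))) =
      eJ (Additive.ofMul (f (Additive.toMul (eI.symm (eI (Additive.ofMul y))))))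
    rw [eI.symm_apply_apply, eI.symm_apply_apply]
    change eJ (Additive.ofMul (f x)) = eJ (Additive.ofMul (f y))
    rw [hxy]
  have h2 := eI.injective (hφi h1)
  exact Additive.ofMul.injective h2

end Hopf

namespace CoherentKummerModel

variable (M : CoherentKummerModel.{u})

/-! ### The third curve `U ⊆ Z ∖ {z} ⊆ Z` and its cusp -/

/-- Data of the third curve for one cusp: an intermediate cofinite open `U ⊆ U_z ⊆ Z` in which exactly the
cusp `z` stays a cusp (law `exists_open_between` with `T = {c ≠ z}`; `Z` proper).
[cite: MochizukiAbsTopIII2015, Thm 1.9 (b) p.37] -/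
theorem exists_third_curve {U Z : M.Curve} (h : M.IsCofiniteOpen U Z) (hZ : M.IsProper Z)
    (z : (M.cusps U).Cusp) :
    ∃ (Uz : M.Curve) (h₁ : M.IsCofiniteOpen U Uz) (_ : M.IsCofiniteOpen Uz Z),
      ∀ c : (M.cusps U).Cusp, M.cuspPt h₁ c = none ↔ c = z := by
  obtain ⟨Uz, h₁, h₂, hiff⟩ :=
    M.exists_open_between h {c | c ≠ z} fun c _ => M.cuspPt_isSome h hZ c
  exact ⟨Uz, h₁, h₂, fun c => by rw [hiff c]; simp⟩

variable {M} in
/-- In the third curve `U_z`, every cusp is the cusp `z` (coherent `cuspRes` + the specification of `U_z`).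
[cite: MochizukiAbsTopIII2015, Prop 1.4 (i) p.31] -/
theorem cusp_eq_cuspRes_of_third {U Uz : M.Curve} {h₁ : M.IsCofiniteOpen U Uz} {z : (M.cusps U).Cusp}
    (hiff : ∀ c : (M.cusps U).Cusp, M.cuspPt h₁ c = none ↔ c = z) (hz : M.cuspPt h₁ z = none)
    (c' : (M.cusps Uz).Cusp) : c' = M.cuspRes h₁ z hz := by
  obtain ⟨c, hc, rfl⟩ := M.exists_cuspRes_eq h₁ c'
  have hcz : c = z := (hiff c).1 hc
  subst hcz
  rfl

/-! ### Prop. 1.4 (i) along `U ⊆ U_z`: inertia groups correspond bijectively -/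

variable {M} in
/-- The image of `I_z ⊆ Π_U` lies in the inertia group of the corresponding cusp of `U_z` (coherent
decomposition groups and `Π_U → Π_{U_z}` maps `Δ` to `Δ`). [cite: MochizukiAbsTopIII2015, Prop 1.4 (i) p.31] -/
theorem inertia_map_le {U Uz : M.Curve} (h₁ : M.IsCofiniteOpen U Uz) (z : (M.cusps U).Cusp)
    (hz : M.cuspPt h₁ z = none) :
    ((M.cusps U).Icusp z).map (M.res h₁).arith.toMonoidHom ≤ (M.cusps Uz).Icusp (M.cuspRes h₁ z hz) := by
  rintro _ ⟨i, hi, rfl⟩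
  rw [(M.cusps U).Icusp_eq] at hi
  rw [(M.cusps Uz).Icusp_eq, ← M.decomp_cuspRes h₁ z hz]
  exact ⟨⟨i, hi.1, rfl⟩, (M.res h₁).mapsTo_geom hi.2⟩

variable {M} in
/-- `I_z ⊆ Π_U` maps ONTO the inertia group of the corresponding cusp of `U_z` (coherent decomposition
groups; `G_k → G_k` injective by Prop. 1.4 (i)). [cite: MochizukiAbsTopIII2015, Prop 1.4 (i) p.31] -/
theorem inertia_surjOn (h14 : M.Prop_1_4_i') {U Uz : M.Curve} (h₁ : M.IsCofiniteOpen U Uz)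
    (hU : M.IsScheme U) (hUz : M.IsScheme Uz) (z : (M.cusps U).Cusp) (hz : M.cuspPt h₁ z = none) :
    Set.SurjOn (M.res h₁).arith ((M.cusps U).Icusp z) ((M.cusps Uz).Icusp (M.cuspRes h₁ z hz)) := by
  intro i' hi'
  have hi'' : i' ∈ (M.cusps Uz).Icusp (M.cuspRes h₁ z hz) := hi'
  rw [(M.cusps Uz).Icusp_eq, ← M.decomp_cuspRes h₁ z hz] at hi''
  obtain ⟨⟨d, hd, hdi⟩, hgeom⟩ := hi''
  refine ⟨d, ?_, hdi⟩
  change d ∈ (M.cusps U).Icusp z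
  rw [(M.cusps U).Icusp_eq]
  refine ⟨hd, ?_⟩
  obtain ⟨-, hbij, -⟩ := h14 U Uz h₁ hU hUz
  change (M.ext U).aug d = 1
  apply hbij.1
  have hc := (M.res h₁).comm d
  rw [map_one, ← hc]
  have : (M.res h₁).arith.toMonoidHom d = i' := hdi
  change (M.ext Uz).aug ((M.res h₁).arith d) = 1
  exact this ▸ hgeom

/-- The cusps of a scheme-like curve of the model have compact (closed) inertia groups.
[cite: MochizukiAbsTopIII2015, Prop 1.4 (i) p.31] -/
theorem compactSpace_Icusp {U : M.Curve} (z : (M.cusps U).Cusp) :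
    CompactSpace ((M.cusps U).Icusp z) :=
  isCompact_iff_compactSpace.mp ((M.cusps U).isClosed_Icusp z).isCompact

variable {M} in
/-- `I_z ⊆ Π_U → Π_{U_z}` is injective on `I_z`: a surjection between the free procyclic profinite groups
`I_z` and `I_{z}(U_z)` (Prop. 1.4 (i): both "naturally isomorphic to `Ẑ(1)`") is injective.
[cite: MochizukiAbsTopIII2015, Prop 1.4 (i) p.31] -/
theorem inertia_injOn (h14i : M.Prop_1_4_i) (h14 : M.Prop_1_4_i') {U Uz : M.Curve}
    (h₁ : M.IsCofiniteOpen U Uz) (hU : M.IsScheme U) (hUz : M.IsScheme Uz) (z : (M.cusps U).Cusp)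
    (hz : M.cuspPt h₁ z = none) :
    Set.InjOn (M.res h₁).arith ((M.cusps U).Icusp z) := by
  haveI := M.compactSpace_Icusp z
  haveI := M.compactSpace_Icusp (M.cuspRes h₁ z hz)
  -- the restricted homomorphism `I_z → I_{z}(U_z)`
  let r : (M.cusps U).Icusp z →* (M.cusps Uz).Icusp (M.cuspRes h₁ z hz) :=
    { toFun := fun i => ⟨(M.res h₁).arith i, inertia_map_le h₁ z hz ⟨i, i.2, rfl⟩⟩
      map_one' := Subtype.ext (map_one _)
      map_mul' := fun _ _ => Subtype.ext (map_mul _ _ _) }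
  have hr : Function.Surjective r := by
    intro i'
    obtain ⟨i, hi, hii'⟩ := inertia_surjOn h14 h₁ hU hUz z hz i'.2
    exact ⟨⟨i, hi⟩, Subtype.ext hii'⟩
  have hinj := injective_of_surjective_of_isFreeProcyclic (h14i U hU z)
    (h14i Uz hUz (M.cuspRes h₁ z hz)) r hr
  intro a ha b hb hab
  have := hinj (a₁ := ⟨a, ha⟩) (a₂ := ⟨b, hb⟩) (Subtype.ext hab)
  exact congrArg Subtype.val this

/-! ### Prop. 1.4 (ii) data of `U_z ⊆ Z`: a cyclotome presentation -/

variable {M} in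
/-- The cusp of `U_z` is rational when `z` is (coherent decomposition groups; `G_k → G_k` surjective).
[cite: MochizukiAbsTopIII2015, Thm 1.9 (b) p.37] -/
theorem isRational_cuspRes (h14 : M.Prop_1_4_i') {U Uz : M.Curve} (h₁ : M.IsCofiniteOpen U Uz)
    (hU : M.IsScheme U) (hUz : M.IsScheme Uz) (z : (M.cusps U).Cusp) (hz : M.cuspPt h₁ z = none)
    (hrat : (M.cusps U).IsRational z) : (M.cusps Uz).IsRational (M.cuspRes h₁ z hz) := by
  obtain ⟨-, hbij, -⟩ := h14 U Uz h₁ hU hUz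
  intro σ' _
  obtain ⟨σ, rfl⟩ := hbij.2 σ'
  obtain ⟨d, hd, hdσ⟩ := hrat (Set.mem_univ σ)
  refine ⟨(M.res h₁).arith d, ?_, ?_⟩
  · rw [← M.decomp_cuspRes h₁ z hz]
    exact ⟨d, hd, rfl⟩
  · rw [(M.res h₁).comm d, hdσ]

variable {M} in
/-- The kernel of `Π_{U_z} → Π_Z` is contained in `Δ_{U_z}` (`G_k → G_k` injective).
[cite: MochizukiAbsTopIII2015, Prop 1.4 (i) p.31] -/
theorem ker_res_le_geom (h14 : M.Prop_1_4_i') {Uz Z : M.Curve} (h₂ : M.IsCofiniteOpen Uz Z)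
    (hUz : M.IsScheme Uz) (hZs : M.IsScheme Z) :
    (M.res h₂).arith.toMonoidHom.ker ≤ (M.ext Uz).geom := by
  obtain ⟨-, hbij, -⟩ := h14 Uz Z h₂ hUz hZs
  intro g hg
  change (M.ext Uz).aug g = 1
  apply hbij.1
  rw [map_one, ← (M.res h₂).comm g]
  have : (M.res h₂).arith g = 1 := hg
  rw [this, map_one]

variable {M} in
/-- The inertia group of a cusp of `U_z` filling a point of the scheme-like `Z` dies in `Π_Z`: its image lies
in `D_y ∩ Δ_Z = 1` (laws `decomp_cuspPt`, `decomp_inf_geom`). [cite: MochizukiAbsTopIII2015, Prop 1.4 (i) p.31] -/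
theorem Icusp_le_ker_res {Uz Z : M.Curve} (h₂ : M.IsCofiniteOpen Uz Z) (hZs : M.IsScheme Z)
    (c : (M.cusps Uz).Cusp) (y : M.Point Z) (hy : M.cuspPt h₂ c = some y) :
    (M.cusps Uz).Icusp c ≤ (M.res h₂).arith.toMonoidHom.ker := by
  obtain ⟨g, hg⟩ := M.decomp_cuspPt h₂ c y hy
  intro i hi
  rw [(M.cusps Uz).Icusp_eq] at hi
  have h1 : (M.res h₂).arith i ∈ ((M.cusps Uz).Dcusp c).map (M.res h₂).arith.toMonoidHom :=
    ⟨i, hi.1, rfl⟩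
  rw [hg] at h1
  have h2 : (M.res h₂).arith i ∈ (M.ext Z).geom := (M.res h₂).mapsTo_geom hi.2
  -- `conj g⁻¹` of the image lies in `D_y ∩ Δ_Z = ⊥`
  have h3 : (MulAut.conj g)⁻¹ ((M.res h₂).arith i) ∈ M.decomp Z y ⊓ (M.ext Z).geom := by
    refine ⟨?_, ?_⟩
    · exact (Subgroup.mem_pointwise_smul_iff_inv_smul_mem).1 h1
    · exact (M.ext Z).normal_geom.conj_mem' _ h2 g
  rw [M.decomp_inf_geom Z hZs y, Subgroup.mem_bot, map_eq_one_iff _ (MulEquiv.injective _)] at h3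
  exact h3

variable {M} in
/-- **`U_z ⊆ Z` with its cusp is a cyclotome presentation** (Prop. 1.4 (ii): `U_z = Z ∖ {z}`, `z` rational,
`I_z ≅ Ẑ`, the cuspidal kernel is the closed normal closure of `I_z`, the extension is cuspidally central)
— from the coherent cusp laws and the named facts Prop. 1.4 (i), (i'), (ii).
[cite: MochizukiAbsTopIII2015, Prop 1.4 (ii) p.31] -/
theorem isCyclotomePresentation_third (h14i : M.Prop_1_4_i) (h14 : M.Prop_1_4_i')
    (h142 : M.Prop_1_4_ii) {U Uz Z : M.Curve} {h₁ : M.IsCofiniteOpen U Uz} (h₂ : M.IsCofiniteOpen Uz Z)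
    (hU : M.IsScheme U) (hZs : M.IsScheme Z) (hZ : M.IsProper Z) {z : (M.cusps U).Cusp}
    (hiff : ∀ c : (M.cusps U).Cusp, M.cuspPt h₁ c = none ↔ c = z) (hz : M.cuspPt h₁ z = none)
    (hrat : (M.cusps U).IsRational z) :
    M.IsCyclotomePresentation h₂ (M.cuspRes h₁ z hz) := by
  have hUz : M.IsScheme Uz := M.isScheme_of_isCofiniteOpen h₂ hZs
  have hratz := isRational_cuspRes h14 h₁ hU hUz z hz hrat
  -- the cuspidal kernel of `Π_{U_z} → Π_Z` is the closed normal closure of `I_z`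
  have hker : cuspidalKernel (M.res h₂) =
      (Subgroup.normalClosure
        ((M.cusps Uz).Icusp (M.cuspRes h₁ z hz) : Set (M.ext Uz).arith)).topologicalClosure := by
    obtain ⟨-, -, S, hS⟩ := h14 Uz Z h₂ hUz hZs
    have hkerle : (M.res h₂).arith.toMonoidHom.ker ≤
        (Subgroup.normalClosure
          ((M.cusps Uz).Icusp (M.cuspRes h₁ z hz) : Set (M.ext Uz).arith)).topologicalClosure := by
      rw [hS]
      apply Subgroup.topologicalClosure_mono
      apply Subgroup.normalClosure_mono
      intro i hi
      simp only [Set.mem_iUnion] at hi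
      obtain ⟨c, -, hic⟩ := hi
      rwa [cusp_eq_cuspRes_of_third hiff hz c] at hic
    have hIle : (M.cusps Uz).Icusp (M.cuspRes h₁ z hz) ≤ (M.res h₂).arith.toMonoidHom.ker := by
      obtain ⟨y, hy⟩ := Option.isSome_iff_exists.1 (M.cuspPt_isSome h₂ hZ (M.cuspRes h₁ z hz))
      exact Icusp_le_ker_res h₂ hZs _ y hy
    have hclosed : IsClosed ((M.res h₂).arith.toMonoidHom.ker : Set (M.ext Uz).arith) :=
      isClosed_singleton.preimage (M.res h₂).arith.continuous
    have hgele : (Subgroup.normalClosure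
          ((M.cusps Uz).Icusp (M.cuspRes h₁ z hz) : Set (M.ext Uz).arith)).topologicalClosure ≤
        (M.res h₂).arith.toMonoidHom.ker :=
      Subgroup.topologicalClosure_minimal _ (Subgroup.normalClosure_le_normal hIle) hclosed
    have heq : (M.res h₂).arith.toMonoidHom.ker = _ := le_antisymm hkerle hgele
    unfold cuspidalKernel
    rw [inf_eq_left.2 (ker_res_le_geom h14 h₂ hUz hZs), heq]
  exact
    { isScheme := ⟨hUz, hZs⟩
      isProper := hZ
      isRational := hratz
      isFreeProcyclic := h14i Uz hUz _
      kernel_eq := hker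
      isCuspidallyCentral := h142 Uz Z h₂ hUz hZs hZ _ hratz hker }

/-! ### The presentations exist; Thm. 1.9 (b) -/

/-- **The cusp-synchronization presentations EXIST** in every law-abiding model: for a cofinite open
`U ⊆ Z` with `U`, `Z` scheme-like, `Z` proper and all cusps of `U` rational, the third curves
`U ⊆ Z ∖ {z} ⊆ Z` of Thm. 1.9 (b) with their Prop. 1.4 (i)/(ii) data (abc-iut-w5-d213's
`CuspSyncPresentation`) — from the laws of `CoherentKummerModel` and the named facts Prop. 1.4 (i), (i'),
(ii) and the bijectivity of the differential BY NAME. [cite: MochizukiAbsTopIII2015, Thm 1.9 (b) p.37] -/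
theorem nonempty_cuspSyncPresentation (h14i : M.Prop_1_4_i) (h14 : M.Prop_1_4_i')
    (h142 : M.Prop_1_4_ii) (hT : M.Prop_1_4_ii_transgression) {U Z : M.Curve}
    (h : M.IsCofiniteOpen U Z) (hU : M.IsScheme U) (hZs : M.IsScheme Z) (hZ : M.IsProper Z)
    (hrat : ∀ c : (M.cusps U).Cusp, (M.cusps U).IsRational c) :
    Nonempty (M.toCurveModel.CuspSyncPresentation h) := by
  choose Uz h₁ h₂ hiff using fun z : (M.cusps U).Cusp => M.exists_third_curve h hZ z
  have hz : ∀ z, M.cuspPt (h₁ z) z = none := fun z => (hiff z z).2 rfl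
  have hUz : ∀ z, M.IsScheme (Uz z) := fun z => M.isScheme_of_isCofiniteOpen (h₂ z) hZs
  have hpres : ∀ z, M.IsCyclotomePresentation (h₂ z) (M.cuspRes (h₁ z) z (hz z)) := fun z =>
    isCyclotomePresentation_third h14i h14 h142 (h₂ z) hU hZs hZ (hiff z) (hz z) (hrat z)
  have hsec : ∀ z, Nonempty (CcnSection (M.res (h₂ z))) := fun z =>
    M.nonempty_ccnSection_res h14 (h₂ z) (hUz z) hZs
  refine ⟨{
    Uz := Uz
    hU := h₁
    hZ := h₂
    res_comp := fun z => M.res_comp (h₁ z) (h₂ z) h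
    cusp := fun z => M.cuspRes (h₁ z) z (hz z)
    pres := hpres
    inertia_le := fun z => inertia_map_le (h₁ z) z (hz z)
    inertia_bijOn := fun z =>
      ⟨fun i hi => inertia_map_le (h₁ z) z (hz z) ⟨i, hi, rfl⟩,
        inertia_injOn h14i h14 (h₁ z) hU (hUz z) z (hz z),
        inertia_surjOn h14 (h₁ z) hU (hUz z) z (hz z)⟩
    sec := fun z => Classical.choice (hsec z)
    bij := fun z => hT (Uz z) Z (h₂ z) _ (hpres z) _
    pt := fun z => (M.cuspPt h z).get (M.cuspPt_isSome h hZ z)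
    decomp_pt := fun z => M.decomp_cuspPt h z _ (Option.some_get _).symm
    pt_injective := by
      intro z z' hzz'
      have h1 : M.cuspPt h z = some ((M.cuspPt h z).get (M.cuspPt_isSome h hZ z)) :=
        (Option.some_get _).symm
      have h2 : M.cuspPt h z' = some ((M.cuspPt h z').get (M.cuspPt_isSome h hZ z')) :=
        (Option.some_get _).symm
      dsimp only at hzz'
      rw [hzz'] at h1
      exact M.cuspPt_inj h z z' _ h1 h2 }⟩

/-- **Thm. 1.9 (b) for every law-abiding model, modulo the named facts Prop. 1.4 (i)(ii)**: the
`D_z`-equivariant isomorphisms `I_z ⥲ M_Z` for all rational cusps `z` of `U ⊆ Z` — abc-iut-w5-d099's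
`thm_1_9_b_of_cuspSyncPresentations` (THE synchronization, bijective by `thm_1_9_b_natural_holds`) with
its presentation hypothesis DISCHARGED by `nonempty_cuspSyncPresentation`.
[cite: MochizukiAbsTopIII2015, Thm 1.9 (b) p.37] -/
theorem thm_1_9_b (h14i : M.Prop_1_4_i) (h14 : M.Prop_1_4_i') (h142 : M.Prop_1_4_ii)
    (hT : M.Prop_1_4_ii_transgression) : M.Thm_1_9_b :=
  M.thm_1_9_b_of_cuspSyncPresentations fun _ _ h hU hZs hZ _ hrat =>
    M.nonempty_cuspSyncPresentation h14i h14 h142 hT h hU hZs hZ hrat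

end CoherentKummerModel

end Literature.AnabelianGeometry.AbsoluteAnabelian.AbsTopIII
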